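import Literature.Barriers.CriticalPhenomena.LaceExpansionIsingDeconvolutionProofs
import HarnessLib

/-!
# Liu–Slade's (1.8)–(1.9) for Sakai's spread-out walk: the nearest-neighbour Green-function
# asymptotics and the comparison `S_1 = δ + C_1/σ² + O(L^{-1+ε}⟦x⟧^{1-d})` as named facts, the
# variance `σ²` in closed form, and Proposition 1.2's bound (1.10) along its printed route

Barrier catalogue `Literature/Barriers/CriticalPhenomena/` (D-0021), a companion of the Ising entry
`LaceExpansionIsingAboveFour`. The named fact `SpreadOutIsing.Sakai2007_thm13_spreadOut` (Sakai
2007, Thm. 1.3, spread-out case) is, by `Sakai2007_thm13_spreadOut_of_three_facts'`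
(`…RandomWalkBound.lean`), the conjunction of three named facts: the random-walk input
`LiuSlade2026_prop12_greenBound` (Liu–Slade 2026, Prop. 1.2, (1.10):
`S_1(x) ≤ δ_{0,x} + K_S L^{-(2-ε)}⟦x⟧^{-(d-2)}`), the deconvolution theorem `LiuSlade2026_thm1_7`
(Thm. 1.7, corrected transcription; `…Deconvolution.lean`) and Sakai's expansion with bounds
`Sakai2007_isingAssumptionH`. The first is now DISCHARGED in the tree
(`LiuSlade2026_prop12_greenBound_holds`, `…DeconvolutionProofs.lean`: the uniform bound of
`…GreenUniform.lean` for `⟦x⟧ ≤ L` and a Gaussian domination of the full-cube walk for `⟦x⟧ > L`),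
so that two named facts remain (`Sakai2007_thm13_spreadOut_of_two_facts` below).

The printed source of (1.10), and an input of the proof of Theorem 1.7 itself (Liu–Slade 2026,
§2.2, last display: `G_{z_c}(x) ∼ λ_{z_c}S_1(x) ∼ (λ_{z_c}/σ²)C_1(x) ∼ (λ_{z_c}/σ²)a_d/|x|^{d-2}`), is
the first display (1.9) of Proposition 1.2, `S_1(x) = δ_{0,x} + C_1(x)/σ² + O(1/(L^{1-ε}⟦x⟧^{d-1}))`
(`C_1` the nearest-neighbour Green function, with (1.8): `C_1(x) = a_d/⟦x⟧^{d-2} + O(1/⟦x⟧^d)`,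
"well-known (e.g., [LL10, Uchi98])"). This file vendors these two displays and records the printed
route to (1.10):

* PROVED: the variance of Sakai's step distribution in closed form,
  `σ² = Σ_x|x|²D(x) = dL(L+1)(2L+1)^d/(3N_L)` (`soVariance_eq`, through
  `Σ_{y∈[-L,L]^d} g(y_i) = (2L+1)^{d-1}Σ_m g(m)`), whence `σ² ≥ (d/3)L²` (`soVariance_ge`; the
  sources' "`σ²` is asymptotic to a multiple of `L²`");
* NAMED FACTS (pure random-walk analysis, not proved here): `LiuSlade2026_nnGreenAsymptotics`
  ((1.8), Lawler–Limic 2010 Thm. 4.3.1 / Lawler 1991 Thm. 1.5.4, for `C_1 = d · latticeGreen`, the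
  tree's lattice Green function of `LatticeGreenFunction.lean`) and `LiuSlade2026_prop12_comparison`
  ((1.9), for `S_1 = soGreen d L 1`, which `soGreen_eq_integral` identifies with the source's Fourier
  integral (1.7));
* PROVED: `LiuSlade2026_prop12_greenBound_of_comparison : (1.8) → (1.9) → LiuSlade2026_prop12_greenBound`
  — the printed route to (1.10), independent of `LiuSlade2026_prop12_greenBound_holds` (case
  `⟦x⟧ ≤ L` by the uniform bound, `C_dL^{-d} ≤ C_dL^{-(2-ε)}⟦x⟧^{-(d-2)}`; case `⟦x⟧ > L` by (1.9)
  with `C_1/σ² ≤ 3(a_d + K)d⁻¹L^{-2}⟦x⟧^{-(d-2)}` and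
  `L^{-(1-ε)}⟦x⟧^{-(d-1)} ≤ L^{-(2-ε)}⟦x⟧^{-(d-2)}`), and the two-fact assembly
  `Sakai2007_thm13_spreadOut_of_two_facts : LiuSlade2026_thm1_7 → Sakai2007_isingAssumptionH →`
  `Sakai2007_thm13_spreadOut` (through `…_of_three_facts'` and `LiuSlade2026_prop12_greenBound_holds`).

## References

* Y. Liu, G. Slade, *Gaussian deconvolution and the lace expansion for spread-out models*, Ann.
  Inst. H. Poincaré Probab. Statist. (2026), arXiv:2310.07640: §1.2.1 (Def. 1.1; (1.6)–(1.8); `σ²`),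
  Prop. 1.2 with (1.9)–(1.10), §2.2 (last display of the proof of Thm. 1.7), Appendix A [LiuSlade2026].
* G. F. Lawler, V. Limic, *Random Walk: A Modern Introduction*, CUP 2010, Thm. 4.3.1 (not held;
  cited as quoted by Liu–Slade) [LawlerLimic2010]; G. F. Lawler, *Intersections of Random Walks*,
  Birkhäuser 1991, Thm. 1.5.4 (`G(x) ∼ a_d|x|^{2-d}`, `a_d = (d/2)Γ(d/2-1)π^{-d/2}`; held, §1.5)
  [Lawler1991].
* T. Hara, R. van der Hofstad, G. Slade, Ann. Probab. 31 (2003) 349–408, arXiv:math-ph/0011046,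
  Prop. 1.3.1 and §6 [HaraHofstadSlade2003].
* A. Sakai, *Lace expansion for the Ising model*, Comm. Math. Phys. 272 (2007) 283–344,
  arXiv:math-ph/0510093, §1.2 ((1.15), `σ² = Σ_x|x|²D(x)`) and Theorem 1.3 [Sakai2007].
-/

noncomputable section

namespace Literature.Barriers.CriticalPhenomena.SpreadOutIsing

open _root_.MeasureTheory Filter _root_.Topology Finset Literature.Probability.LatticeModels
open scoped BigOperators

variable {d L : ℕ}

/-! ## The variance of the step distribution -/

section GreenDecay

open Real

/-- Sums over the cube of a function of one coordinate factor:
`Σ_{y ∈ [-L,L]^d} g(y_i) = (2L+1)^{d-1} Σ_{m=-L}^{L} g(m)`. [folklore] -/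
theorem sum_box_apply (L : ℕ) (i : Fin d) (g : ℤ → ℝ) :
    ∑ y ∈ box d L, g (y i) = (2 * L + 1 : ℝ) ^ (d - 1) * ∑ m ∈ Finset.Icc (-(L : ℤ)) L, g m := by
  classical
  have hd : 1 ≤ d := Nat.succ_le_of_lt (Fin.pos i)
  -- `Π_j Σ_m f j m = Σ_y Π_j f j (y j)` with `f j = g` at `j = i` and `1` elsewhere
  set f : Fin d → ℤ → ℝ := fun j m => if j = i then g m else 1 with hf
  have key := Finset.prod_univ_sum (fun _ : Fin d => Finset.Icc (-(L : ℤ)) L) f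
  have hrhs : ∀ y : Site d, ∏ j, f j (y j) = g (y i) := by
    intro y
    rw [Finset.prod_eq_single i]
    · simp [hf]
    · intro j _ hji; simp [hf, hji]
    · intro h; exact absurd (Finset.mem_univ i) h
  have hlhs : ∏ j, ∑ m ∈ Finset.Icc (-(L : ℤ)) L, f j m =
      (∑ m ∈ Finset.Icc (-(L : ℤ)) L, g m) * (2 * L + 1 : ℝ) ^ (d - 1) := by
    have hsum : ∀ j : Fin d, ∑ m ∈ Finset.Icc (-(L : ℤ)) L, f j m =
        if j = i then ∑ m ∈ Finset.Icc (-(L : ℤ)) L, g m else (2 * L + 1 : ℝ) := by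
      intro j
      by_cases hji : j = i
      · simp [hf, hji]
      · simp only [hf, hji, if_false, Finset.sum_const, Int.card_Icc, nsmul_eq_mul, mul_one]
        rw [show (L : ℤ) + 1 - -(L : ℤ) = ((2 * L + 1 : ℕ) : ℤ) by push_cast; ring, Int.toNat_natCast]
        push_cast; ring
    simp_rw [hsum]
    rw [Finset.prod_ite, Finset.prod_const, Finset.prod_const, Finset.filter_eq' Finset.univ i,
      if_pos (Finset.mem_univ i), Finset.card_singleton, pow_one, Finset.filter_ne',
      Finset.card_erase_of_mem (Finset.mem_univ i), Finset.card_univ, Fintype.card_fin]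
  rw [box, ← Finset.sum_congr rfl fun y _ => hrhs y, ← key, hlhs, mul_comm]

/-- **The variance in closed form**: `σ² = Σ_x |x|²D(x) = d L(L+1)(2L+1)^d/(3N_L)`.
[cite: Sakai2007, §1.2 (σ² = Σ_x |x|² D(x))] [cite: LiuSlade2026, §1.2.1 (σ² is asymptotic to a multiple of L²)] -/
theorem soVariance_eq (hd : 1 ≤ d) (L : ℕ) :
    soVariance d L = d * ((L : ℝ) * (L + 1) * (2 * L + 1) ^ d / 3) / soCount d L := by
  unfold soVariance
  rw [← Finset.sum_mul, neighborFinset_zero_eq_erase_box, Finset.sum_erase _ (by simp [euclidNorm]),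
    ← div_eq_mul_inv]
  congr 1
  simp_rw [euclidNorm_sq]
  rw [Finset.sum_comm]
  have hi : ∀ i : Fin d, ∑ y ∈ box d L, ((y i : ℤ) : ℝ) ^ 2 =
      (L : ℝ) * (L + 1) * (2 * L + 1) ^ d / 3 := by
    intro i
    rw [sum_box_apply L i (fun m : ℤ => ((m : ℝ)) ^ 2), sum_Icc_neg_sq]
    have hM : (2 * L + 1 : ℝ) ^ d = (2 * L + 1) ^ (d - 1) * (2 * L + 1) := by
      rw [← pow_succ, Nat.sub_add_cancel hd]
    rw [hM]; ring
  rw [Finset.sum_congr rfl fun i _ => hi i, Finset.sum_const, Finset.card_univ, Fintype.card_fin,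
    nsmul_eq_mul]

/-- **`σ² ≥ (d/3) L²`** for `d, L ≥ 1` (since `(2L+1)^d ≥ N_L` and `L(L+1) ≥ L²`).
[cite: LiuSlade2026, §1.2.1 (σ² is asymptotic to a multiple of L²)] -/
theorem soVariance_ge (hd : 1 ≤ d) (hL : 1 ≤ L) : (d : ℝ) / 3 * (L : ℝ) ^ 2 ≤ soVariance d L := by
  rw [soVariance_eq hd L]
  have hN : (0 : ℝ) < soCount d L := by exact_mod_cast soCount_pos hd hL
  have hNM : (soCount d L : ℝ) ≤ (2 * L + 1) ^ d := by
    have := soCount_add_one d L; linarith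
  have hL0 : (0 : ℝ) ≤ L := Nat.cast_nonneg L
  have hd0 : (0 : ℝ) ≤ d := Nat.cast_nonneg d
  rw [le_div_iff₀ hN]
  calc (d : ℝ) / 3 * (L : ℝ) ^ 2 * soCount d L ≤ (d : ℝ) / 3 * (L : ℝ) ^ 2 * (2 * L + 1) ^ d := by
        gcongr
    _ ≤ d * ((L : ℝ) * (L + 1) * (2 * L + 1) ^ d / 3) := by
        have h1 : (L : ℝ) ^ 2 ≤ (L : ℝ) * (L + 1) := by nlinarith
        have h2 : (0 : ℝ) ≤ (2 * L + 1) ^ d := by positivity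
        nlinarith [mul_le_mul_of_nonneg_right h1 h2]

/-! ### Liu–Slade's (1.8) and (1.9): named facts -/

/-- NAMED FACT — **the nearest-neighbour Green function asymptotics, Liu–Slade 2026, (1.8):**
"When `D(x)` is replaced by `D_nn(x) = (1/2d) 1_{|x|=1}`, we have the nearest-neighbour random walk,
and we denote its Green function by `C_μ(x)` … In the critical case `μ = 1`, it is well-known
(e.g., [LL10, Uchi98]) that `C_1(x) = a_d/⟦x⟧^{d-2} + O(1/⟦x⟧^d)`,
`a_d = dΓ((d-2)/2)/(2π^{d/2})` (`d > 2`)" — Lawler–Limic 2010, Thm. 4.3.1; Lawler 1991,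
Thm. 1.5.4 prints `G(x) ∼ a_d|x|^{2-d}` with `|x|^α(G(x) - a_d|x|^{2-d}) → 0` for every `α < d`.
Transcription: `C_1` is the Fourier integral (1.7) with `D_nn`, i.e. `d` times the tree's
`latticeGreen x = ∫_{[-π,π]^d} cos(p·x)/ε(p) dp/(2π)^d` (`ε = Σ_i(1 - cos p_i) = d(1 - D̂_nn)`,
`LatticeGreenFunction.lean`); `⟦x⟧ = jnorm x`; `a_d = gaussianAmp d`. Named fact (the local
central limit theorem route of Lawler–Limic, or Uchiyama's), not proved here.
[cite: LiuSlade2026, §1.2.1, (1.8)] [cite: LawlerLimic2010, Theorem 4.3.1 (as quoted by Liu–Slade 2026, (1.8))]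
[cite: Lawler1991, Theorem 1.5.4 (G(x) ∼ a_d |x|^{2-d}, a_d = (d/2)Γ(d/2 - 1)π^{-d/2})] -/
def LiuSlade2026_nnGreenAsymptotics : Prop :=
  ∀ d : ℕ, 2 < d → ∃ K : ℝ, ∀ x : Site d,
    |(d : ℝ) * latticeGreen x - gaussianAmp d / jnorm x ^ ((d : ℝ) - 2)| ≤ K / jnorm x ^ (d : ℝ)

/-- NAMED FACT — **Liu–Slade 2026, Proposition 1.2, first display (1.9)** (the spread-out Green
function against the nearest-neighbour one): "Let `d > 2`, `ε > 0`, and `L ≥ L₀`. Then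
`S_1(x) = δ_{0,x} + (1/σ²) C_1(x) + O(1/(L^{1-ε}⟦x⟧^{d-1}))`, with the constant uniform in `L` but
dependent on `ε`" (`L₀` depending only on `d` and the step profile `v`, §1.2.1). Transcribed for
Sakai's uniformly spread-out step distribution (`soStep`, an instance of Def. 1.1) with
`S_1 = soGreen d L 1` (equal to the source's Fourier integral (1.7) by `soGreen_eq_integral`),
`σ² = soVariance d L`, `C_1 = d · latticeGreen`, `⟦x⟧ = jnorm x`; conservatively, `L₀` is quantified
after `ε` (it may depend on `ε`, weaker than printed). Appendix A of the source (the method of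
Liu–Slade 2024), not proved here. [cite: LiuSlade2026, Proposition 1.2, (1.9)] -/
def LiuSlade2026_prop12_comparison : Prop :=
  ∀ d : ℕ, 2 < d → ∀ ε : ℝ, 0 < ε → ∃ K : ℝ, ∃ L₀ : ℕ, ∀ L : ℕ, L₀ ≤ L → ∀ x : Site d,
    |soGreen d L 1 x - delta0 x - (d : ℝ) * latticeGreen x / soVariance d L| ≤
      K / ((L : ℝ) ^ (1 - ε) * jnorm x ^ ((d : ℝ) - 1))

/-- **Liu–Slade's Proposition 1.2 bound (1.10) from (1.8), (1.9) and the uniform bound** — the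
printed route to `LiuSlade2026_prop12_greenBound` (the tree's discharge
`LiuSlade2026_prop12_greenBound_holds` goes instead through a Gaussian domination of the full-cube
walk): for `⟦x⟧ ≤ L`,
`S_1(x) - δ_{0,x} ≤ C_dL^{-d} ≤ C_d L^{-(2-ε)}⟦x⟧^{-(d-2)}` (`soGreen_one_le_delta_add_uniform`); for
`⟦x⟧ > L`, `S_1(x) = δ + C_1(x)/σ² + O(L^{-(1-ε)}⟦x⟧^{-(d-1)})` with
`C_1(x)/σ² ≤ (a_d + K)⟦x⟧^{-(d-2)}/((d/3)L²)` and `L^{-(1-ε)}⟦x⟧^{-(d-1)} ≤ L^{-(2-ε)}⟦x⟧^{-(d-2)}`.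
[cite: LiuSlade2026, Proposition 1.2, (1.9)–(1.10)] [cite: HaraHofstadSlade2003, §6 (the two halves |x| ≤ L, |x| > L of the bound on S_1)] -/
theorem LiuSlade2026_prop12_greenBound_of_comparison (h8 : LiuSlade2026_nnGreenAsymptotics)
    (h9 : LiuSlade2026_prop12_comparison) : LiuSlade2026_prop12_greenBound := by
  intro d hd ε hε
  have hd3 : 3 ≤ d := hd
  have hd1 : 1 ≤ d := by omega
  obtain ⟨C, hC0, hC⟩ := soGreen_one_le_delta_add_uniform (d := d) hd3
  obtain ⟨K₉, L₉, h9'⟩ := h9 d hd ε hε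
  obtain ⟨K₈, h8'⟩ := h8 d hd
  have ha := gaussianAmp_pos hd3
  set a := gaussianAmp d with ha_def
  have hdpos : (0 : ℝ) < d := by exact_mod_cast (by omega : 0 < d)
  set KS : ℝ := C + 3 * (a + |K₈|) / d + |K₉| + 1 with hKS
  have hKSpos : 0 < KS := by
    have : 0 ≤ 3 * (a + |K₈|) / d := by positivity
    have : 0 ≤ |K₉| := abs_nonneg _
    rw [hKS]; linarith
  refine ⟨KS, hKSpos, max L₉ 1, fun L hL x => ?_⟩
  have hL9 : L₉ ≤ L := le_trans (le_max_left _ _) hL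
  have hL1 : 1 ≤ L := le_trans (le_max_right _ _) hL
  set ℓ : ℝ := (L : ℝ) with hℓ
  have hℓ1 : (1 : ℝ) ≤ ℓ := by rw [hℓ]; exact_mod_cast hL1
  have hℓ0 : 0 < ℓ := by linarith
  set r : ℝ := jnorm x with hr
  have hr1 : 1 ≤ r := one_le_jnorm x
  have hr0 : 0 < r := by linarith
  -- the target power `ℓ^{-(2-ε)} r^{-(d-2)}` and its basic lower bounds
  set P : ℝ := ℓ ^ (-(2 - ε)) * r ^ (-((d : ℝ) - 2)) with hP
  have hP0 : 0 < P := by rw [hP]; positivity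
  by_cases hcase : r ≤ ℓ
  · -- `⟦x⟧ ≤ L`: the uniform bound
    have h1 := hC L hL1 x
    have hpow : C / (L : ℝ) ^ d ≤ KS * P := by
      have hCle : C ≤ KS := by
        have : 0 ≤ 3 * (a + |K₈|) / d := by positivity
        have : 0 ≤ |K₉| := abs_nonneg _
        rw [hKS]; linarith
      -- `1/L^d ≤ P`
      have hinv : ((L : ℝ) ^ d)⁻¹ ≤ P := by
        have e1 : ((L : ℝ) ^ d)⁻¹ = ℓ ^ (-(d : ℝ)) := by
          rw [Real.rpow_neg hℓ0.le, Real.rpow_natCast]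
        rw [e1, hP]
        calc ℓ ^ (-(d : ℝ)) ≤ ℓ ^ (-(2 - ε) + -((d : ℝ) - 2)) :=
              Real.rpow_le_rpow_of_exponent_le hℓ1 (by linarith)
          _ = ℓ ^ (-(2 - ε)) * ℓ ^ (-((d : ℝ) - 2)) := Real.rpow_add hℓ0 _ _
          _ ≤ ℓ ^ (-(2 - ε)) * r ^ (-((d : ℝ) - 2)) := by
              refine mul_le_mul_of_nonneg_left ?_ (by positivity)
              exact Real.rpow_le_rpow_of_nonpos hr0 hcase (by
                have : (3 : ℝ) ≤ d := by exact_mod_cast hd3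
                linarith)
      calc C / (L : ℝ) ^ d = C * ((L : ℝ) ^ d)⁻¹ := div_eq_mul_inv _ _
        _ ≤ KS * P := mul_le_mul hCle hinv (by positivity) hKSpos.le
    calc soGreen d L 1 x ≤ delta0 x + C / (L : ℝ) ^ d := h1
      _ ≤ delta0 x + KS * P := by linarith
      _ = delta0 x + KS * (L : ℝ) ^ (-(2 - ε)) * jnorm x ^ (-((d : ℝ) - 2)) := by
          rw [hP]; ring
  · -- `⟦x⟧ > L`: comparison with the nearest-neighbour Green function
    rw [not_le] at hcase
    have h2 := h9' L hL9 x
    have h3 := h8' x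
    have hσ := soVariance_ge (d := d) hd1 hL1
    have hσpos : 0 < soVariance d L := lt_of_lt_of_le (by positivity) hσ
    -- `C_1(x) ≤ (a + |K₈|) r^{-(d-2)}`
    have hrd2 : 0 < r ^ ((d : ℝ) - 2) := by positivity
    have hrd : 0 < r ^ (d : ℝ) := by positivity
    have hC1 : (d : ℝ) * latticeGreen x ≤ (a + |K₈|) * r ^ (-((d : ℝ) - 2)) := by
      have hK8 : K₈ / r ^ (d : ℝ) ≤ |K₈| * r ^ (-((d : ℝ) - 2)) := by
        rw [Real.rpow_neg hr0.le, ← div_eq_mul_inv]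
        calc K₈ / r ^ (d : ℝ) ≤ |K₈| / r ^ (d : ℝ) :=
              div_le_div_of_nonneg_right (le_abs_self _) hrd.le
          _ ≤ |K₈| / r ^ ((d : ℝ) - 2) := by
              refine div_le_div_of_nonneg_left (abs_nonneg _) hrd2 ?_
              exact Real.rpow_le_rpow_of_exponent_le hr1 (by linarith)
      have := (abs_le.1 h3).2
      have e : a / r ^ ((d : ℝ) - 2) = a * r ^ (-((d : ℝ) - 2)) := by
        rw [Real.rpow_neg hr0.le, div_eq_mul_inv]
      calc (d : ℝ) * latticeGreen x ≤ a / r ^ ((d : ℝ) - 2) + K₈ / r ^ (d : ℝ) := by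
            linarith
        _ ≤ a * r ^ (-((d : ℝ) - 2)) + |K₈| * r ^ (-((d : ℝ) - 2)) := by
            rw [← e]; linarith
        _ = (a + |K₈|) * r ^ (-((d : ℝ) - 2)) := by ring
    -- `C_1/σ² ≤ 3(a+|K₈|)/d · ℓ^{-2} r^{-(d-2)} ≤ 3(a+|K₈|)/d · P`
    have hterm1 : (d : ℝ) * latticeGreen x / soVariance d L ≤ 3 * (a + |K₈|) / d * P := by
      have hnum : 0 ≤ (a + |K₈|) * r ^ (-((d : ℝ) - 2)) := by positivity
      calc (d : ℝ) * latticeGreen x / soVariance d L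
          ≤ (a + |K₈|) * r ^ (-((d : ℝ) - 2)) / soVariance d L :=
            div_le_div_of_nonneg_right hC1 hσpos.le
        _ ≤ (a + |K₈|) * r ^ (-((d : ℝ) - 2)) / ((d : ℝ) / 3 * ℓ ^ 2) :=
            div_le_div_of_nonneg_left hnum (by positivity) hσ
        _ = 3 * (a + |K₈|) / d * (ℓ ^ (-(2 : ℝ)) * r ^ (-((d : ℝ) - 2))) := by
            rw [Real.rpow_neg hℓ0.le, Real.rpow_two]; field_simp
        _ ≤ 3 * (a + |K₈|) / d * P := by
            rw [hP]
            refine mul_le_mul_of_nonneg_left ?_ (by positivity)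
            refine mul_le_mul_of_nonneg_right ?_ (by positivity)
            exact Real.rpow_le_rpow_of_exponent_le hℓ1 (by linarith)
    -- the error term: `K₉/(ℓ^{1-ε} r^{d-1}) ≤ |K₉| P`
    have hterm2 : K₉ / (ℓ ^ (1 - ε) * r ^ ((d : ℝ) - 1)) ≤ |K₉| * P := by
      have hden : 0 < ℓ ^ (1 - ε) * r ^ ((d : ℝ) - 1) := by positivity
      calc K₉ / (ℓ ^ (1 - ε) * r ^ ((d : ℝ) - 1)) ≤ |K₉| / (ℓ ^ (1 - ε) * r ^ ((d : ℝ) - 1)) :=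
            div_le_div_of_nonneg_right (le_abs_self _) hden.le
        _ = |K₉| * (ℓ ^ (-(1 - ε)) * (r ^ (-((d : ℝ) - 2)) * r ^ (-(1 : ℝ)))) := by
            rw [← Real.rpow_add hr0, show -((d : ℝ) - 2) + -(1 : ℝ) = -((d : ℝ) - 1) by ring,
              Real.rpow_neg hr0.le, Real.rpow_neg hℓ0.le]
            field_simp
        _ ≤ |K₉| * (ℓ ^ (-(1 - ε)) * (r ^ (-((d : ℝ) - 2)) * ℓ ^ (-(1 : ℝ)))) := by
            gcongr _ * (_ * (_ * ?_))
            exact Real.rpow_le_rpow_of_nonpos hℓ0 hcase.le (by norm_num)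
        _ = |K₉| * P := by
            rw [hP, show -(2 - ε) = -(1 - ε) + -(1 : ℝ) by ring, Real.rpow_add hℓ0]; ring
    have hsum : soGreen d L 1 x ≤ delta0 x + (d : ℝ) * latticeGreen x / soVariance d L +
        K₉ / (ℓ ^ (1 - ε) * r ^ ((d : ℝ) - 1)) := by
      have := (abs_le.1 h2).2; linarith
    have hKS' : 3 * (a + |K₈|) / d * P + |K₉| * P ≤ KS * P := by
      rw [hKS]
      have : 0 ≤ C * P := by positivity
      nlinarith
    calc soGreen d L 1 x ≤ delta0 x + 3 * (a + |K₈|) / d * P + |K₉| * P := by linarith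
      _ ≤ delta0 x + KS * P := by linarith
      _ = delta0 x + KS * (L : ℝ) ^ (-(2 - ε)) * jnorm x ^ (-((d : ℝ) - 2)) := by
          rw [hP]; ring

/-- **Sakai's Theorem 1.3 (spread-out) from two named facts**: Liu–Slade's Theorem 1.7 in its
corrected transcription (`LiuSlade2026_thm1_7`) and Sakai's lace expansion with diagrammatic bounds
(`Sakai2007_isingAssumptionH`) — the random-walk input `LiuSlade2026_prop12_greenBound` of
`Sakai2007_thm13_spreadOut_of_three_facts'` being discharged (`LiuSlade2026_prop12_greenBound_holds`,
`…DeconvolutionProofs.lean`). [cite: Sakai2007, Theorem 1.3 (SO model)] [cite: LiuSlade2026, Proposition 1.2 and Theorem 1.7] -/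
theorem Sakai2007_thm13_spreadOut_of_two_facts (h1 : LiuSlade2026_thm1_7)
    (h2 : Sakai2007_isingAssumptionH) : Sakai2007_thm13_spreadOut :=
  Sakai2007_thm13_spreadOut_of_three_facts' LiuSlade2026_prop12_greenBound_holds h1 h2

end GreenDecay

end Literature.Barriers.CriticalPhenomena.SpreadOutIsing

end
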